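import Summits.SmoothPoincare4.SmoothPoincare4.Theorems.SullivanDualWitnessChargeCompletePackaging
import Summits.SmoothPoincare4.SmoothPoincare4.Theorems.SullivanDualWitnessChargeFlatChart

/-!
# Helper `helper_endHolomorphic` (E0: holomorphy in the flat end) of line `Sketch` for crux
`WitnessCharge` (item stmt-SmoothPoincare4-7824, route `SullivanDual`, crux
`Summit.SmoothPoincare4.SmoothPoincare4.Theses.SullivanDual.WitnessCharge`; registered stub
`helper_endHolomorphic` of the lead's cycle-2 helper skeleton)

For `J` STANDARD on the punctured chart-ball `B_{ε'}` at `p` (`Dψ ∘ J = J₀ ∘ Dψ` in the flat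
coordinates `ψ x = ι(e x − e p)`, `e = extChartAt (𝓡 4) p`; `Dpsi_J`), a `C^∞` `J`-holomorphic map
`u : ℂ → Σ ∖ p` is an honest holomorphic map in the complex flat coordinates
`Ycoord p = complexify ∘ ψ` on the open set `U = u⁻¹(B_{ε'})`:

* chain rule (`hasMFDerivAt_Ycoord_comp`): `d(Y ∘ u)(ξ) = complexify ∘ Dψ(u ξ) ∘ du(ξ)`
  (`hasMFDerivAt_psi` for `ψ`, `ContMDiff.mdifferentiableAt` for `u`, the linear `complexifyL`,
  and `mfderiv = fderiv` between vector spaces);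
* `J`-holomorphy `du(iζ) = J du(ζ)`, standardness `Dψ ∘ J = J₀ ∘ Dψ` and
  `complexify ∘ J₀ = i • complexify` (`complexify_J0`) give `d(Y ∘ u)(ξ)(iζ) = i • d(Y ∘ u)(ξ) ζ`,
  so the real derivative is complex linear (`exists_restrictScalars_eq_of_map_mul_I`) and `Y ∘ u`
  is complex differentiable (`differentiableAt_iff_restrictScalars`);
* smoothness: `contMDiffAt_Ycoord` composed with `u` (`contMDiffAt_iff_contDiffAt`);
* `U` is open as the preimage of the open punctured chart-ball.

References: M. Gromov, *Pseudo holomorphic curves in symplectic manifolds*, Invent. Math. 82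
(1985), §2.4.A [Gromov1985]; C. Hummel, *Gromov's compactness theorem for pseudo-holomorphic
curves* (1997), Ch. I §3 (in complex-analytic coordinates `(3.1)` is the Cauchy–Riemann system)
[Hummel1997].
-/

noncomputable section

-- the prescribed namespace `Summit.<P>.<Sub>.…` duplicates `SmoothPoincare4` (P = Sub)
set_option linter.dupNamespace false

open scoped Manifold ContDiff Topology
open Set Filter Literature.Geometry.Kaehler Literature.Geometry.Symplectic
  Literature.Topology.FourManifolds

namespace Summit.SmoothPoincare4.SmoothPoincare4.Theorems.WitnessCharge.PencilIncompleteness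

variable {S : HomotopySphere 4} {p : S.carrier} {ε' : ℝ} {u : ℂ → punctured p}

/-! ### The chain rule for `Ycoord ∘ u` on `u⁻¹(B_{ε'})` -/

/-- **Chain rule in the flat end.** Along a `C^∞` map `u : ℂ → Σ ∖ p`, at a point mapped into the
punctured `ε'`-chart-ball, `Ycoord p ∘ u = complexify ∘ ψ ∘ u` has the (manifold) derivative
`complexify ∘ Dψ(u ξ) ∘ du(ξ)`. -/
theorem hasMFDerivAt_Ycoord_comp (hu : ContMDiff 𝓘(ℝ, ℂ) (𝓡 4) ∞ u) {ξ : ℂ}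
    (hx : InPuncturedChartBall p ε' (u ξ)) :
    HasMFDerivAt 𝓘(ℝ, ℂ) 𝓘(ℝ, ℂ × ℂ) (fun ξ : ℂ => Ycoord p (u ξ)) ξ
      (complexifyL.comp ((Dpsi p (u ξ)).comp (mfderiv 𝓘(ℝ, ℂ) (𝓡 4) u ξ))) := by
  have hψ : HasMFDerivAt (𝓡 4) 𝓘(ℝ, EuclideanSpace ℝ (Fin 4)) (psi p) (u ξ) (Dpsi p (u ξ)) :=
    hasMFDerivAt_psi hx
  have hc : HasMFDerivAt 𝓘(ℝ, EuclideanSpace ℝ (Fin 4)) 𝓘(ℝ, ℂ × ℂ) complexifyL (psi p (u ξ))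
      complexifyL :=
    hasMFDerivAt_iff_hasFDerivAt.2 complexifyL.hasFDerivAt
  have hu' : HasMFDerivAt 𝓘(ℝ, ℂ) (𝓡 4) u ξ (mfderiv 𝓘(ℝ, ℂ) (𝓡 4) u ξ) :=
    ((hu ξ).mdifferentiableAt (by simp)).hasMFDerivAt
  have h1 : HasMFDerivAt 𝓘(ℝ, ℂ) 𝓘(ℝ, ℂ × ℂ) (complexifyL ∘ (psi p ∘ u)) ξ
      (complexifyL.comp ((Dpsi p (u ξ)).comp (mfderiv 𝓘(ℝ, ℂ) (𝓡 4) u ξ))) :=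
    hc.comp ξ (hψ.comp ξ hu')
  have hfun : (complexifyL ∘ (psi p ∘ u) : ℂ → ℂ × ℂ) = fun ξ : ℂ => Ycoord p (u ξ) :=
    funext fun ξ => (Ycoord_eq_complexify p (u ξ)).symm
  rwa [hfun] at h1

/-- Pointwise form of the chain rule for the Fréchet derivative (`mfderiv = fderiv` between vector
spaces): `d(Ycoord ∘ u)(ξ) ζ = complexify (Dψ(u ξ) (du(ξ) ζ))`. -/
theorem fderiv_Ycoord_comp_apply (hu : ContMDiff 𝓘(ℝ, ℂ) (𝓡 4) ∞ u) {ξ : ℂ}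
    (hx : InPuncturedChartBall p ε' (u ξ)) (ζ : ℂ) :
    fderiv ℝ (fun ξ : ℂ => Ycoord p (u ξ)) ξ ζ =
      complexify (Dpsi p (u ξ) (mfderiv 𝓘(ℝ, ℂ) (𝓡 4) u ξ ζ)) := by
  have h := (hasMFDerivAt_Ycoord_comp hu hx).mfderiv
  rw [mfderiv_eq_fderiv] at h
  exact DFunLike.congr_fun h ζ

/-- `Ycoord ∘ u` is real differentiable at every point of `u⁻¹(B_{ε'})`. -/
theorem differentiableAt_real_Ycoord_comp (hu : ContMDiff 𝓘(ℝ, ℂ) (𝓡 4) ∞ u) {ξ : ℂ}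
    (hx : InPuncturedChartBall p ε' (u ξ)) :
    DifferentiableAt ℝ (fun ξ : ℂ => Ycoord p (u ξ)) ξ :=
  (hasMFDerivAt_Ycoord_comp hu hx).mdifferentiableAt.differentiableAt

/-! ### Complex linearity of the derivative for `J`-holomorphic `u` and standard `J` -/

/-- `i • q = (i q.1, i q.2)` on `ℂ × ℂ`. -/
theorem I_smul_prod (q : ℂ × ℂ) : Complex.I • q = (Complex.I * q.1, Complex.I * q.2) :=
  Prod.ext (by simp) (by simp)

/-- For `J` standard on the punctured `ε'`-chart-ball and `u` `J`-holomorphic, the real derivative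
of `Ycoord ∘ u` at a point of `u⁻¹(B_{ε'})` commutes with multiplication by `i`:
`d(Y ∘ u)(ξ)(iζ) = complexify (Dψ (J du ζ)) = complexify (J₀ (Dψ du ζ)) = i • d(Y ∘ u)(ξ) ζ`. -/
theorem fderiv_Ycoord_comp_mul_I
    (J : ∀ x : punctured p, TangentSpace (𝓡 4) x →L[ℝ] TangentSpace (𝓡 4) x)
    (hJstd : ∀ x : punctured p, InPuncturedChartBall p ε' x →
      ∀ (v : TangentSpace (𝓡 4) x) (b : EuclideanSpace ℝ (Fin 4)),
        inner ℝ (fderiv ℝ inversion (extChartAt (𝓡 4) p x.1 - extChartAt (𝓡 4) p p)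
          (mfderiv (𝓡 4) 𝓘(ℝ, EuclideanSpace ℝ (Fin 4))
            (fun z : punctured p => extChartAt (𝓡 4) p z.1) x (J x v))) b
        = stdSymplecticForm (fderiv ℝ inversion (extChartAt (𝓡 4) p x.1 - extChartAt (𝓡 4) p p)
          (mfderiv (𝓡 4) 𝓘(ℝ, EuclideanSpace ℝ (Fin 4))
            (fun z : punctured p => extChartAt (𝓡 4) p z.1) x v)) b)
    (hu : ContMDiff 𝓘(ℝ, ℂ) (𝓡 4) ∞ u) (hhol : IsJHolomorphic (𝓡 4) J u) {ξ : ℂ}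
    (hx : InPuncturedChartBall p ε' (u ξ)) (ζ : ℂ) :
    fderiv ℝ (fun ξ : ℂ => Ycoord p (u ξ)) ξ (Complex.I * ζ) =
      Complex.I • fderiv ℝ (fun ξ : ℂ => Ycoord p (u ξ)) ξ ζ := by
  rw [fderiv_Ycoord_comp_apply hu hx, fderiv_Ycoord_comp_apply hu hx, hhol ξ ζ,
    Dpsi_J J hJstd hx, complexify_J0, I_smul_prod]

/-- Hence `Ycoord ∘ u` is complex differentiable at every point of `u⁻¹(B_{ε'})` (a real
continuous linear map `ℂ → ℂ × ℂ` commuting with `i` is complex linear). -/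
theorem differentiableAt_Ycoord_comp
    (J : ∀ x : punctured p, TangentSpace (𝓡 4) x →L[ℝ] TangentSpace (𝓡 4) x)
    (hJstd : ∀ x : punctured p, InPuncturedChartBall p ε' x →
      ∀ (v : TangentSpace (𝓡 4) x) (b : EuclideanSpace ℝ (Fin 4)),
        inner ℝ (fderiv ℝ inversion (extChartAt (𝓡 4) p x.1 - extChartAt (𝓡 4) p p)
          (mfderiv (𝓡 4) 𝓘(ℝ, EuclideanSpace ℝ (Fin 4))
            (fun z : punctured p => extChartAt (𝓡 4) p z.1) x (J x v))) b
        = stdSymplecticForm (fderiv ℝ inversion (extChartAt (𝓡 4) p x.1 - extChartAt (𝓡 4) p p)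
          (mfderiv (𝓡 4) 𝓘(ℝ, EuclideanSpace ℝ (Fin 4))
            (fun z : punctured p => extChartAt (𝓡 4) p z.1) x v)) b)
    (hu : ContMDiff 𝓘(ℝ, ℂ) (𝓡 4) ∞ u) (hhol : IsJHolomorphic (𝓡 4) J u) {ξ : ℂ}
    (hx : InPuncturedChartBall p ε' (u ξ)) :
    DifferentiableAt ℂ (fun ξ : ℂ => Ycoord p (u ξ)) ξ := by
  rw [differentiableAt_iff_restrictScalars ℝ (differentiableAt_real_Ycoord_comp hu hx)]
  exact exists_restrictScalars_eq_of_map_mul_I _ fun ζ =>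
    fderiv_Ycoord_comp_mul_I J hJstd hu hhol hx ζ

/-! ### Smoothness -/

/-- `Ycoord ∘ u` is `C^∞` (over `ℝ`) at every point of `u⁻¹(B_{ε'})`. -/
theorem contDiffAt_Ycoord_comp (hu : ContMDiff 𝓘(ℝ, ℂ) (𝓡 4) ∞ u) {ξ : ℂ}
    (hx : InPuncturedChartBall p ε' (u ξ)) :
    ContDiffAt ℝ ∞ (fun ξ : ℂ => Ycoord p (u ξ)) ξ :=
  contMDiffAt_iff_contDiffAt.1 ((contMDiffAt_Ycoord hx).comp ξ (hu ξ))

/-! ### Openness of `u⁻¹(B_{ε'})` -/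

/-- `u⁻¹(B_{ε'})` is open for continuous `u`. -/
theorem isOpen_preimage_ball (hu : Continuous u) :
    IsOpen {ξ : ℂ | InPuncturedChartBall p ε' (u ξ)} :=
  ((gromov_recognitionR4_relEnd.isOpen_chartBall p ε').preimage continuous_subtype_val).preimage hu

/-! ### The helper -/

/-- **Holomorphy in the end (E0).** For `J` standard on the punctured chart-ball `B_{ε'}` at `p`
(closed `ε'`-ball inside the chart target) and a `C^∞` `J`-holomorphic `u : ℂ → Σ ∖ p`, on the
open set `U = u⁻¹(B_{ε'})` the map `Ycoord ∘ u : ℂ → ℂ × ℂ` is complex differentiable and `C^∞`,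
with real derivative `d(Ycoord ∘ u)(ξ) ζ = complexify (Dψ(u ξ) (du(ξ) ζ))`: the bridge from
`J`-holomorphic maps into the flat end to one-variable complex analysis.
(Line `Sketch`, `Lines/Sketch.md`, flat-coordinate paragraph; Hummel 1997 Ch. I §3.) -/
theorem helper_endHolomorphic :
    ∀ (S : HomotopySphere 4) (p : S.carrier)
      (J : ∀ x : punctured p, TangentSpace (𝓡 4) x →L[ℝ] TangentSpace (𝓡 4) x) (ε' : ℝ),
      0 < ε' →
      Metric.closedBall (extChartAt (𝓡 4) p p) ε' ⊆ (extChartAt (𝓡 4) p).target →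
      (∀ x : punctured p, InPuncturedChartBall p ε' x →
        ∀ (v : TangentSpace (𝓡 4) x) (b : EuclideanSpace ℝ (Fin 4)),
          inner ℝ (fderiv ℝ inversion (extChartAt (𝓡 4) p x.1 - extChartAt (𝓡 4) p p)
            (mfderiv (𝓡 4) 𝓘(ℝ, EuclideanSpace ℝ (Fin 4))
              (fun z : punctured p => extChartAt (𝓡 4) p z.1) x (J x v))) b
          = stdSymplecticForm (fderiv ℝ inversion (extChartAt (𝓡 4) p x.1 - extChartAt (𝓡 4) p p)
            (mfderiv (𝓡 4) 𝓘(ℝ, EuclideanSpace ℝ (Fin 4))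
              (fun z : punctured p => extChartAt (𝓡 4) p z.1) x v)) b) →
      ∀ (u : ℂ → punctured p), ContMDiff 𝓘(ℝ, ℂ) (𝓡 4) ∞ u → IsJHolomorphic (𝓡 4) J u →
        IsOpen {ξ : ℂ | InPuncturedChartBall p ε' (u ξ)} ∧
        DifferentiableOn ℂ (fun ξ : ℂ => Ycoord p (u ξ)) {ξ : ℂ | InPuncturedChartBall p ε' (u ξ)} ∧
        ContDiffOn ℝ ∞ (fun ξ : ℂ => Ycoord p (u ξ)) {ξ : ℂ | InPuncturedChartBall p ε' (u ξ)} ∧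
        ∀ ξ : ℂ, InPuncturedChartBall p ε' (u ξ) → ∀ ζ : ℂ,
          fderiv ℝ (fun ξ : ℂ => Ycoord p (u ξ)) ξ ζ =
            complexify (Dpsi p (u ξ) (mfderiv 𝓘(ℝ, ℂ) (𝓡 4) u ξ ζ)) := by
  intro S p J ε' _hε' _hball hJstd u hu hhol
  exact ⟨isOpen_preimage_ball hu.continuous,
    fun ξ hξ => (differentiableAt_Ycoord_comp J hJstd hu hhol hξ).differentiableWithinAt,
    fun ξ hξ => (contDiffAt_Ycoord_comp hu hξ).contDiffWithinAt,
    fun ξ hξ ζ => fderiv_Ycoord_comp_apply hu hξ ζ⟩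

end Summit.SmoothPoincare4.SmoothPoincare4.Theorems.WitnessCharge.PencilIncompleteness
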